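import Summits.Ventures.HSemireg.WedgeHankelRecurrenceGaussChebyshevLucasLehmerProduct

/-!
# Venture HSemireg — **THE LIFTING-THE-EXPONENT SKELETON FOR `C_n − 2`: `C_{(2q+1)k} − 2 = (C_k − 2) · W_q(C_k)²` with `W_q = S_q + S_{q−1}`, `W_q(2) = 2q + 1` and `C_k − 2 ∣ W_q(C_k) − (2q+1)`; and
# `C_{2k} − 2 = (C_k − 2)(C_k + 2)`** — all `q, k ∈ ℤ`, every commutative ring.  Integer reading for `V_n(P, 1)`: **`V_{(2q+1)k} − 2 = (V_k − 2) · w²` with `w ≡ 2q+1 (mod V_k − 2)`** (so for an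
# odd prime `p ∤ V_k − 2`… resp. `p ∣ V_k − 2`, `p ∤ 2q+1`: `v_p(V_{(2q+1)k} − 2) = v_p(V_k − 2)` — the valuation bookkeeping itself is not typed here), from the composition law `C_{mk} = C_m ∘ C_k`
# and the monic half-angle factorisation N485 `C_{2q+1} − 2 = (X − 2) W_q²`

HONEST FRAMING. Part of the Lean index of the computation cell `pub-hsemireg` (seat p10 gen 48, Sunday typer «UNIFORM-IN-n»).  Polynomial ∕ integer algebra only; no variety, no cohomology theory, no
sheaf, no Ext group and no semiregularity map is constructed here; nothing here says that HC / HC_CM / HC_AV holds; no Literature fact (unproved `Prop`) is declared or used.  Custodian versions as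
in `WedgeHankelSiegelIdeal` (1/3).
SOURCES (cited).  Yu. Bilu, G. Hanrot, P. M. Voutier, J. reine angew. Math. 539 (2001) 75–122, §2 (Lucas ∕ Lehmer valuations); P. Ribenboim, *My Numbers, My Friends* (2000), Ch. 1 §IV ((IV.18)–(IV.20),
the law of repetition); R. Lidl, G. L. Mullen, G. Turnwald, *Dickson Polynomials* (1993), Ch. 2.
PROOF TYPED HERE.  Mathlib `Polynomial.Chebyshev.C_mul` (composition), `S_eval_two`, `sub_comp ∕ mul_comp ∕ pow_comp ∕ add_comp ∕ X_comp ∕ ofNat_comp`; N485 `chebyshevC_two_mul_add_one_sub_two`,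
`chebyshevC_two_mul_add_two`; N488 `chebyshev_sub_C_dvd_comp_sub_C`; N476 `lucasV_one_eq_chebyshevC_eval`.
DEDUP DISCLOSURE (`rg -n 'chebyshevW_eval_two|chebyshevC_odd_mul_sub_two|chebyshevC_two_mul_sub_two_eq_mul|chebyshevC_sub_two_dvd_W_comp|lucasV_one_odd_mul_sub_two' Summits Literature HarnessLib`,
2026-09-04): `Literature/NumberTheory/LucasSequences/LawOfRepetition*.lean` (integer `p`-adic laws for `U_n`, general `P, Q`) — different statements; 0 hits for the 5 names below.

WHAT IS IN THE TREE.  N476, N485, N488, N489.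
THIS FILE (namespace `Summit.Ventures.HSemireg.Wedge.HankelOuter` continued; CHAINED on N492; 0 definitions):
* §1258 `chebyshevW_eval_two`, **`chebyshevC_odd_mul_sub_two`**, `chebyshevC_two_mul_sub_two_eq_mul`, **`chebyshevC_sub_two_dvd_W_comp_sub`**, **`lucasV_one_odd_mul_sub_two`**.
CAVEATS.  No valuation statement is typed (only the algebraic skeleton).  Nothing Ext-side.  New names only.
-/

open Module Polynomial
open scoped Matrix Polynomial

namespace Summit.Ventures.HSemireg.Wedge.HankelOuter

/-! ## §1258. `C_{(2q+1)k} − 2 = (C_k − 2) W_q(C_k)²` -/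

/-- `W_q(2) = 2q + 1` for `W_q = S_q + S_{q−1}` (`q ∈ ℤ`). [Mathlib `S_eval_two`; this file, §1258] -/
theorem chebyshevW_eval_two {R : Type*} [CommRing R] (q : ℤ) :
    (Polynomial.Chebyshev.S R q + Polynomial.Chebyshev.S R (q - 1)).eval 2 = 2 * (q : R) + 1 := by
  rw [eval_add, Polynomial.Chebyshev.S_eval_two, Polynomial.Chebyshev.S_eval_two, Int.cast_sub, Int.cast_one]; ring

/-- **`C_{(2q+1)k} − 2 = (C_k − 2) · W_q(C_k)²`** for all `q, k ∈ ℤ` in every commutative ring (`W_q = S_q + S_{q−1}`). [Lidl–Mullen–Turnwald Ch. 2; this file, §1258] -/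
theorem chebyshevC_odd_mul_sub_two {R : Type*} [CommRing R] (q k : ℤ) :
    Polynomial.Chebyshev.C R ((2 * q + 1) * k) - 2 =
      (Polynomial.Chebyshev.C R k - 2) * ((Polynomial.Chebyshev.S R q + Polynomial.Chebyshev.S R (q - 1)).comp (Polynomial.Chebyshev.C R k)) ^ 2 := by
  have h := congrArg (fun p => p.comp (Polynomial.Chebyshev.C R k)) (chebyshevC_two_mul_add_one_sub_two (R := R) q)
  simp only [sub_comp, mul_comp, pow_comp, X_comp, ofNat_comp, Nat.cast_ofNat] at h
  rw [Polynomial.Chebyshev.C_mul, h]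

/-- `C_{2k} − 2 = (C_k − 2)(C_k + 2)` (all `k ∈ ℤ`). [this file, §1258] -/
theorem chebyshevC_two_mul_sub_two_eq_mul {R : Type*} [CommRing R] (k : ℤ) :
    Polynomial.Chebyshev.C R (2 * k) - 2 = (Polynomial.Chebyshev.C R k - 2) * (Polynomial.Chebyshev.C R k + 2) := by
  have h := chebyshevC_two_mul_add_two (R := R) k
  linear_combination h

/-- **`C_k − 2 ∣ W_q(C_k) − (2q + 1)`** (all `q, k ∈ ℤ`): the cofactor `W_q(C_k)` is `≡ 2q+1` modulo `C_k − 2`. [this file, §1258] -/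
theorem chebyshevC_sub_two_dvd_W_comp_sub {R : Type*} [CommRing R] (q k : ℤ) :
    Polynomial.Chebyshev.C R k - 2 ∣ (Polynomial.Chebyshev.S R q + Polynomial.Chebyshev.S R (q - 1)).comp (Polynomial.Chebyshev.C R k) - (2 * (q : R[X]) + 1) := by
  have h := chebyshev_sub_C_dvd_comp_sub_C (Polynomial.Chebyshev.S R q + Polynomial.Chebyshev.S R (q - 1)) (Polynomial.Chebyshev.C R k) 2
  rwa [chebyshevW_eval_two, Polynomial.C_ofNat, map_add, map_mul, map_intCast, map_one, Polynomial.C_ofNat] at h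

/-- **`V_{(2q+1)k} − 2 = (V_k − 2) · w²` with `w ≡ 2q + 1 (mod V_k − 2)`** for `V_0 = 2, V_1 = P, V_{j+2} = P V_{j+1} − V_j` over `ℤ` (`q, k ∈ ℕ`). [Ribenboim Ch. 1 §IV; this file, §1258] -/
theorem lucasV_one_odd_mul_sub_two {P : ℤ} {V : ℕ → ℤ} (hV0 : V 0 = 2) (hV1 : V 1 = P) (hV : ∀ n, V (n + 2) = P * V (n + 1) - V n) (q k : ℕ) :
    ∃ w : ℤ, V ((2 * q + 1) * k) - 2 = (V k - 2) * w ^ 2 ∧ V k - 2 ∣ w - (2 * q + 1) := by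
  refine ⟨((Polynomial.Chebyshev.S ℤ (q : ℤ) + Polynomial.Chebyshev.S ℤ ((q : ℤ) - 1)).comp (Polynomial.Chebyshev.C ℤ (k : ℤ))).eval P, ?_, ?_⟩
  · have h := congrArg (Polynomial.eval P) (chebyshevC_odd_mul_sub_two (R := ℤ) (q : ℤ) (k : ℤ))
    rw [eval_sub, eval_ofNat, eval_mul, eval_pow, eval_sub, eval_ofNat] at h
    rw [lucasV_one_eq_chebyshevC_eval hV0 hV1 hV ((2 * q + 1) * k), lucasV_one_eq_chebyshevC_eval hV0 hV1 hV k]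
    push_cast
    exact h
  · obtain ⟨c, hc⟩ := chebyshevC_sub_two_dvd_W_comp_sub (R := ℤ) (q : ℤ) (k : ℤ)
    refine ⟨c.eval P, ?_⟩
    have h := congrArg (Polynomial.eval P) hc
    rw [eval_sub, eval_add, eval_mul, eval_ofNat, eval_intCast, eval_one, eval_mul, eval_sub, eval_ofNat] at h
    rw [lucasV_one_eq_chebyshevC_eval hV0 hV1 hV k]
    exact h

end Summit.Ventures.HSemireg.Wedge.HankelOuter
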